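import Summits.ResolutionOfSingularities.ResolutionOfSingularities.Theorems.FrobeniusClosingPatchingRelPerfectDepthParamLiftFlat
import Mathlib.RingTheory.RegularLocalRing.Polynomial
import HarnessLib

/-!
# Crux `PatchingRelPerfect` (stmt-ResolutionOfSingularities-16161), chain W5.2 — F7(β) d = 2 (β-AX), X2a module 2 (M2c), e-chart algebra II:
# PARAM-LIFT data for «adjoin one polynomial variable and localise at a prime over the maximal ideal»

[OURS · L1 W5.2 · F7(β) (β-AX) X-side · res-D-pv-034 AS res-L1-s36-pv-3 per res-L1-w52-plan-1 RULING G11-21 ((M2c) PARAM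
PROPAGATION, e-chart half).]  Replaces the role of NO printed item; NOT a statement of the manuscript under review; fact-free,
def-free.  AI-written; AI review is weaker than expert review.

Modulo the matched exceptional parameter the e-chart stalk map of the lifted retraction is `R → R[X]_𝔭` for the regular local
ring `R = 𝒪_{Z′,z′}/(aᵢ) ≅ (A/𝔞)[T̂ᵢ]_𝔮̄` and a prime `𝔭 ⊂ R[X]` over `𝔪_R` (the fibre coordinate `X = t/eᵢ`).  This file PROVES
its PARAM-LIFT data, following Mathlib's `Polynomial.isRegularLocalRing_localization_atPrime_of_comap_eq_maximalIdeal`: either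
`𝔭 = 𝔪_R R[X]` (no extra parameter, `ht 𝔭 = ht 𝔪_R`) or `𝔭 = 𝔪_R R[X] + (y)` with `y` monic (ONE extra parameter,
`ht 𝔭 = ht 𝔪_R + 1`).

* **`exists_finset_sup_span_eq_maximalIdeal_polynomial`** — `R` regular local, `𝔭 ⊂ R[X]` prime with `𝔭.comap C = 𝔪_R`:
  `∃ s, 𝔪_R · R[X]_𝔭 ⊔ (s) = 𝔪_{R[X]_𝔭}` and `#s + emb dim R = emb dim R[X]_𝔭` (for `Localization.AtPrime 𝔭`; transport to any
  other localisation by `exists_finset_sup_span_eq_maximalIdeal_of_ringEquiv`).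

## References
* H. Matsumura, *Commutative Ring Theory* (1986), Thm. 15.1, Thm. 23.7. [Matsumura1987]
-/

-- `Summit.<Summit>.<Sub>.Theorems` with `Sub = Summit` (single-conjunct summit, D-0017)
set_option linter.dupNamespace false

noncomputable section

open IsLocalRing Polynomial Ideal
open Literature.AlgebraicGeometry.Resolution

namespace Summit.ResolutionOfSingularities.ResolutionOfSingularities.Theorems.DepthMultiHost

universe u

/-- [OURS · L1 W5.2 · F7(β) (β-AX) M2c] **PARAM-LIFT data for `R → R[X]_𝔭`, `𝔭` a prime over `𝔪_R`, `R` regular local.**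
[cite: Matsumura1987, Thm. 23.7] -/
theorem exists_finset_sup_span_eq_maximalIdeal_polynomial {R : Type u} [CommRing R] [IsRegularLocalRing R] (p : Ideal R[X])
    [p.IsPrime] (hp : p.comap C = maximalIdeal R) :
    ∃ s : Finset (Localization.AtPrime p),
      (maximalIdeal R).map ((algebraMap R[X] (Localization.AtPrime p)).comp C) ⊔
          Ideal.span (s : Set (Localization.AtPrime p)) = maximalIdeal (Localization.AtPrime p) ∧
        s.card + (maximalIdeal R).spanFinrank = (maximalIdeal (Localization.AtPrime p)).spanFinrank := by
  classical
  haveI hPreg : IsRegularLocalRing (Localization.AtPrime p) :=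
    Polynomial.isRegularLocalRing_localization_atPrime_of_comap_eq_maximalIdeal R p hp
  have qle : (maximalIdeal R).map C ≤ p := by rw [← hp]; exact map_comap_le
  have hmaxP : maximalIdeal (Localization.AtPrime p) = p.map (algebraMap R[X] (Localization.AtPrime p)) :=
    (Localization.AtPrime.map_eq_maximalIdeal).symm
  -- dimensions
  have hdimP : ((maximalIdeal (Localization.AtPrime p)).spanFinrank : WithBot ℕ∞) = p.height := by
    rw [IsRegularLocalRing.spanFinrank_maximalIdeal, IsLocalization.AtPrime.ringKrullDim_eq_height p (Localization.AtPrime p)]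
  have hdimR : ((maximalIdeal R).spanFinrank : WithBot ℕ∞) = (maximalIdeal R).height := by
    rw [IsRegularLocalRing.spanFinrank_maximalIdeal, maximalIdeal_height_eq_ringKrullDim]
  have hq_height : ((maximalIdeal R).map C).height = (maximalIdeal R).height := height_map_C (maximalIdeal R)
  by_cases hpq : p = (maximalIdeal R).map C
  · -- no extra parameter
    refine ⟨∅, ?_, ?_⟩
    · rw [Finset.coe_empty, Ideal.span_empty, sup_bot_eq, ← Ideal.map_map, hmaxP]
      exact congrArg _ hpq.symm
    · rw [Finset.card_empty, zero_add]
      have h : ((maximalIdeal R).spanFinrank : WithBot ℕ∞) = (maximalIdeal (Localization.AtPrime p)).spanFinrank := by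
        rw [hdimP, hdimR, ← hq_height]
        exact congrArg _ (congrArg _ hpq.symm)
      exact_mod_cast h
  · -- one extra parameter: a monic `y` with `p = 𝔪 R[X] ⊔ (y)`
    have hmax : (p.comap C).IsMaximal := by rw [hp]; exact maximalIdeal.isMaximal R
    obtain ⟨y, -, hy⟩ := Polynomial.exists_monic_span_sup_map_eq R p hmax (by rw [hp]; exact hpq)
    rw [hp] at hy
    have hmap : p.map (algebraMap R[X] (Localization.AtPrime p)) =
        ((maximalIdeal R).map C).map (algebraMap R[X] (Localization.AtPrime p)) ⊔
          Ideal.span {algebraMap R[X] (Localization.AtPrime p) y} := by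
      have h := congrArg (Ideal.map (algebraMap R[X] (Localization.AtPrime p))) hy
      rw [Ideal.map_sup, Ideal.map_span, Set.image_singleton] at h
      exact h
    refine ⟨{algebraMap R[X] (Localization.AtPrime p) y}, ?_, ?_⟩
    · rw [Finset.coe_singleton, ← Ideal.map_map, hmaxP, hmap]
    · -- `ht p ≥ ht 𝔪_R + 1` from `𝔪 R[X] < p`; `emb dim ≤ emb dim R + 1` from the generators
      rw [Finset.card_singleton]
      have lt : (maximalIdeal R).map C < p := lt_of_le_of_ne qle (Ne.symm hpq)
      have h1 : ((maximalIdeal R).map C).height + 1 ≤ p.height := Ideal.height_add_one_le_of_lt_of_isPrime lt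
      obtain ⟨G, hGcard, hGspan⟩ := Submodule.FG.exists_span_finset_card_eq_spanFinrank
        (maximalIdeal R).fg_of_isNoetherianRing
      have hgen : maximalIdeal (Localization.AtPrime p) =
          Ideal.span ((G.image ((algebraMap R[X] (Localization.AtPrime p)).comp C) : Finset _) ∪
            {algebraMap R[X] (Localization.AtPrime p) y} : Set _) := by
        rw [hmaxP, hmap, Ideal.span_union, Ideal.map_map, Finset.coe_image, ← Ideal.map_span,
          show Ideal.span (G : Set R) = maximalIdeal R from hGspan]
      have h2 : (maximalIdeal (Localization.AtPrime p)).spanFinrank ≤ (maximalIdeal R).spanFinrank + 1 := by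
        rw [hgen]
        refine (Submodule.spanFinrank_span_le_ncard_of_finite (Set.toFinite _)).trans ?_
        refine (Set.ncard_union_le _ _).trans ?_
        rw [Set.ncard_singleton, Set.ncard_coe_finset, ← hGcard]
        exact Nat.add_le_add_right Finset.card_image_le 1
      have h3 : ((maximalIdeal R).spanFinrank : WithBot ℕ∞) + 1 ≤ (maximalIdeal (Localization.AtPrime p)).spanFinrank := by
        rw [hdimP, hdimR, ← hq_height]
        exact_mod_cast h1
      have h3' : (maximalIdeal R).spanFinrank + 1 ≤ (maximalIdeal (Localization.AtPrime p)).spanFinrank := by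
        exact_mod_cast h3
      omega

end Summit.ResolutionOfSingularities.ResolutionOfSingularities.Theorems.DepthMultiHost

end
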